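/-
Origin: expansion seat `planner-pub-hodgecm-pv04-g7-0`, handover #3 2026-08-18T13:01:07Z (SUPERSEDES f63e4880a9c1) md5 c54bd41f8daf91faf4d840d9fef09a5b ; new (L2, additive leaf; imports Mathlib + HodgeCM.CM.TypeOfDet (r29) + HodgeCM.PerL34.GaloisB3CM; NO rewrite; land after HodgeCM/CM/TypeOfDet.lean) (`HOME/pub-hodgecm-pv04-g7/lean/Pv04g7/ReflexFieldPerL.lean`, md5 c54bd41f, 121 lines);
landed by the gen-8 packager in gate run 30 as `HodgeCM/PerL34/ReflexFieldPerL.lean` (verbatim).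
-/
/-
Copyright: pub-hodgecm formalisation cell (harness21, 2026). New file (not vendored).
Origin: HOME/pub-hodgecm-pv04-g7/lean/Pv04g7/ReflexFieldPerL.lean (final-form imports; intended place
`HodgeCM/PerL34/ReflexFieldPerL.lean` = module `HodgeCM.PerL34.ReflexFieldPerL`, CONTRIBUTING §3 kind L2: field/Galois algebra in
PerL's binders over the landed `HodgeCM.PerL34.GaloisB3CM` (pv01) and `HodgeCM.CM.TypeOfDet` (pv04-g7); no `Universe`, no facts)
(seat planner-pub-hodgecm-pv04-g7-0, DAG-node prover #04 gen 7, seam S6 / node N12a, dictionary readings R3/R4 of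
`HodgeCM.Universe.ThetaModel.Fact_thetaAlbanese`).
-/
import Mathlib
import Summits.HodgeConjecture.HodgeCM.CM.TypeOfDet
import Summits.HodgeConjecture.HodgeCM.PerL34.GaloisB3CM

/-!
# In PerL's binders the reflex field of `(L, Φ(Ψ))` is exactly `j(K)`

PerL v5 Lemma 2.1(b) (tex l. 128: "`A_{Ψ_t} = Φ̃_t`, `Stab(Ψ_t) = H`, `L^*_{Ψ_t} = K`, `Ψ_t^* = Φ_t`") in the language of the
seam-S6 dictionary (`HodgeCM.CM.ReflexInflateDict`: the group `L ≃+* L` acting on `K →+* L`, `CMTypeOps.pullType`,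
`ReflexWelldef.aSet`).  With `A := aSet (pullType ι₁ Ψ) j` — the `L`-type `Ψ_t` of PerL §2 for `t = Ψ`, `φ^h = 1`, whose
`ι₁`-image is `Φ(Ψ) = reflexInflateSet j ι₁ Ψ` (`CMTypeOps.reflexInflateSet_eq`) — and `Stab₂ := Stab(A)` (left
multiplication; `= ` the right stabiliser of `Ψ̃ = A⁻¹ = aSet A 1`, `ReflexWelldef.rightStab_iff`):

* `stabilizer_reflexSet_eq_stabilizer` — under PerL's standing hypotheses (`L` a normal closure of the sextic `K`,
  `[L:ℚ] ∈ {24, 48}`, `ι₁ ∘ j ∈ Ψ`): `Stab₂ = Stab(j)` (`= Gal(L/jK) = H`), i.e. the reflex field of `(L, Φ(Ψ))` IS `j(K)`.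
  The inclusion `Stab(j) ≤ Stab₂` is general (`CMTypeOps.stabilizer_le_stabilizer_reflexSet`); the converse is the
  primitivity of the CM types of PerL's `K` — KERNEL since pv01's `GaloisB3.perL_rightStab_tilde_eq_H` ([Y1neg] Lemma 7.1(b)
  as a theorem, stated for `L ≃ₐ[ℚ] L`), transported here along `L ≃+* L → L ≃ₐ[ℚ] L` (`toRatAlgEquiv`).
* `doubleReflex_eq_aSet_aSet` — `A₂ · Stab₂ = A₂` (general: `Stab₂` is the right stabiliser of `A₂`), so the inflation to `K` of the
  reflex type is read directly on `Ψ̃` (`CMTypeOps.comp_mem_iff_mem_doubleReflex` = `Ψ_t^* = Φ_t` of Lemma 2.1(b) once `Stab₂ = H`);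
  `apply_eq_of_mem_stabilizer_reflexSet` — the field form used by R4: an automorphism stabilising `Φ(Ψ)` fixes `j(K)` pointwise.

Consequence for the dictionary reading R4 of `ThetaModel.Fact_thetaAlbanese` (`PerL34/ThetaSubOfLiu.lean`): in PerL's own binders
Liu's reflex field `M'_{μᵢ}` of `(L, Φ_{μᵢ})`, `Φ_{μᵢ} = Φ(Ψᵢ)`, equals `σ(K)`, so `M := M_{μᵢ}`, `k := (M'_{μᵢ} ⊆ M_{μᵢ}) ∘ (σ : K ≅ M'_{μᵢ})`
is available there; the compositum `M_{μᵢ}·σ(K)` is only needed for the wider quantification of `Fact_thetaAlbanese`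
(GAPS.md pv04g7-K1).  No new constant, no axiom, no proof placeholder; nothing cited.
-/

set_option autoImplicit false

open scoped Pointwise

namespace HodgeCM
namespace CMTypeOps

section PerLBinders

open Literature.AlgebraicGeometry.Motives (CMType)
open HodgeCM.PerL34.ReflexWelldef (aSet mem_aSet rightStab_iff)
open HodgeCM.Prior.ReflexLemma.RfwfReflex (rightStab RStab)

variable {K L : CMField}

/-- A ring automorphism of `L` as a `ℚ`-algebra automorphism (every ring map fixes `ℚ`). -/
noncomputable def toRatAlgEquiv (u : L ≃+* L) : L ≃ₐ[ℚ] L :=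
  AlgEquiv.ofRingEquiv (f := u) (fun q => by simp)

/-- (Ported verbatim from the HodgeCMPerL package; no docstring in the source.) -/
@[simp] theorem toRatAlgEquiv_apply (u : L ≃+* L) (x : L) : toRatAlgEquiv u x = u x := rfl

/-- (Ported verbatim from the HodgeCMPerL package; no docstring in the source.) -/
theorem coe_toRatAlgEquiv (u : L ≃+* L) : ((toRatAlgEquiv u : L ≃ₐ[ℚ] L) : L →+* L) = u.toRingHom :=
  RingHom.ext fun _ => rfl

/-- (Ported verbatim from the HodgeCMPerL package; no docstring in the source.) -/
theorem coe_mul_toRatAlgEquiv (x : L ≃ₐ[ℚ] L) (u : L ≃+* L) :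
    ((x * toRatAlgEquiv u : L ≃ₐ[ℚ] L) : L →+* L) = (x.toRingEquiv * u).toRingHom :=
  RingHom.ext fun _ => rfl

/-- (Ported verbatim from the HodgeCMPerL package; no docstring in the source.) -/
theorem coe_eq_toRingEquiv (x : L ≃ₐ[ℚ] L) : ((x : L ≃ₐ[ℚ] L) : L →+* L) = x.toRingEquiv.toRingHom :=
  RingHom.ext fun _ => rfl

/-- Membership in `Ψ̃ = A₂ = aSet A 1` read in `Hom(K, ℂ)`: `τ ∈ Ψ̃ ⟺ ι₁ ∘ τ ∘ j ∈ Ψ`. -/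
theorem mem_aSet_aSet_pullType_iff (j : K →+* L) (ι₁ : L →+* ℂ) (Ψ : CMType K) (τ : L ≃+* L) :
    τ ∈ (aSet (aSet (pullType ι₁ Ψ) j : Set (L ≃+* L)) (1 : L ≃+* L) : Set (L ≃+* L)) ↔
      ι₁.comp (τ.toRingHom.comp j) ∈ Ψ.1 := by
  rw [mem_aSet_aSet_one_iff, smul_def, mem_pullType]

/-- **PerL Lemma 2.1(b) `Stab(Ψ_t) = H` / `L^*_{Ψ_t} = K` in the dictionary's language.**  In PerL's binders (`L` a normal
closure of `K` over `ℚ`, `[K:ℚ] = 6`, `[L:ℚ] ∈ {24, 48}`, `ι₁ ∘ j ∈ Ψ`) the stabiliser of the `L`-type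
`A = aSet (pullType ι₁ Ψ) j` (whose `ι₁`-image is `Φ(Ψ)`) is exactly `Stab(j) = Gal(L/jK)`: the reflex field of `(L, Φ(Ψ))` is `j(K)`. -/
theorem stabilizer_reflexSet_eq_stabilizer [IsNormalClosure ℚ K L]
    (hK : Module.finrank ℚ K = 6) (hL : Module.finrank ℚ L = 24 ∨ Module.finrank ℚ L = 48)
    (j : K →+* L) (ι₁ : L →+* ℂ) (Ψ : CMType K) (h1 : ι₁.comp j ∈ Ψ.1) :
    MulAction.stabilizer (L ≃+* L) (aSet (pullType ι₁ Ψ) j : Set (L ≃+* L)) =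
      MulAction.stabilizer (L ≃+* L) j := by
  refine le_antisymm ?_ (stabilizer_le_stabilizer_reflexSet j ι₁ Ψ)
  intro u hu
  -- `u` right-stabilises `Ψ̃ = aSet A 1` ([Y1neg] l. 190–191 at group level, `E := G` acting on itself)
  have hR : ∀ τ : L ≃+* L,
      τ * u ∈ (aSet (aSet (pullType ι₁ Ψ) j : Set (L ≃+* L)) (1 : L ≃+* L) : Set (L ≃+* L)) ↔
        τ ∈ (aSet (aSet (pullType ι₁ Ψ) j : Set (L ≃+* L)) (1 : L ≃+* L) : Set (L ≃+* L)) :=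
    (rightStab_iff (G := L ≃+* L) (aSet (pullType ι₁ Ψ) j : Set (L ≃+* L)) (1 : L ≃+* L) u).2 hu
  -- transport to `ℚ`-algebra automorphisms, where pv01's primitivity theorem lives
  have hu' : toRatAlgEquiv u ∈
      rightStab {g : L ≃ₐ[ℚ] L | ι₁.comp ((g : L →+* L).comp j) ∈ Ψ.1} := by
    intro x
    rw [Set.mem_setOf_eq, Set.mem_setOf_eq, coe_mul_toRatAlgEquiv, coe_eq_toRingEquiv,
      ← mem_aSet_aSet_pullType_iff, ← mem_aSet_aSet_pullType_iff]
    exact hR x.toRingEquiv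
  have hfix := (HodgeCM.PerL34.GaloisB3.perL_rightStab_tilde_iff K L j hK hL ι₁ Ψ h1 (toRatAlgEquiv u)).1 hu'
  rw [MulAction.mem_stabilizer_iff, smul_def]
  exact RingHom.ext fun k => hfix k

/-- The double-reflex set `A₂ · Stab₂` of `CMTypeOps.comp_mem_iff_mem_doubleReflex` is `Ψ̃ = A₂` itself (in general — `Stab₂` is the
right stabiliser of `A₂`, [Y1neg] l. 190–191; no PerL hypothesis): PerL §2 l. 121 "`A_Ψ` is a union of left cosets of `Stab(Ψ)`". -/
theorem doubleReflex_eq_aSet_aSet (j : K →+* L) (ι₁ : L →+* ℂ) (Ψ : CMType K) :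
    (aSet (aSet (pullType ι₁ Ψ) j : Set (L ≃+* L)) (1 : L ≃+* L) : Set (L ≃+* L)) *
        (MulAction.stabilizer (L ≃+* L) (aSet (pullType ι₁ Ψ) j : Set (L ≃+* L)) : Set (L ≃+* L)) =
      (aSet (aSet (pullType ι₁ Ψ) j : Set (L ≃+* L)) (1 : L ≃+* L) : Set (L ≃+* L)) := by
  ext g
  rw [← comp_mem_iff_mem_doubleReflex, mem_aSet_aSet_pullType_iff]

/-- The reflex field statement as used by R4: every automorphism stabilising the `L`-type `Φ(Ψ)` fixes `j(K)` pointwise. -/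
theorem apply_eq_of_mem_stabilizer_reflexSet [IsNormalClosure ℚ K L]
    (hK : Module.finrank ℚ K = 6) (hL : Module.finrank ℚ L = 24 ∨ Module.finrank ℚ L = 48)
    (j : K →+* L) (ι₁ : L →+* ℂ) (Ψ : CMType K) (h1 : ι₁.comp j ∈ Ψ.1) {u : L ≃+* L}
    (hu : u ∈ MulAction.stabilizer (L ≃+* L) (aSet (pullType ι₁ Ψ) j : Set (L ≃+* L))) (k : K) :
    u (j k) = j k := by
  rw [stabilizer_reflexSet_eq_stabilizer hK hL j ι₁ Ψ h1, MulAction.mem_stabilizer_iff, smul_def] at hu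
  exact RingHom.congr_fun hu k

end PerLBinders

end CMTypeOps
end HodgeCM
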